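import Summits.HodgeConjecture.CorCM.MumfordTateRankEqHodgeLieRankAddOne
import Summits.HodgeConjecture.CorCM.MumfordTateRankOfCMAbelianVariety
import Literature.AlgebraicGeometry.Motives.HodgeLieOfAbelianVarietyBiproduct
import Literature.AlgebraicGeometry.Motives.AbelianVarietyIsogenousProductOfSimples
import HarnessLib

/-!
# `dim MT(H¹X)` is subadditive in the factors: `t(X) + |J| ≤ Σ_j t(A_j) + 1` for `X ∼ ⨁_j A_j`,
# `t(X) + 1 ≤ t(X₁) + t(X₂)` for `X ∼ X₁ × X₂`, and `t(X) ≤ t(X₁) + dim X₂` when `X₂` is of CM type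

COR-CM (cell `pub-hodgecm2`, seat `b27` gen 43, count-neutral Mumford–Tate-rank ladder; theorems only, no definition, no
named fact; UNCONDITIONAL — nothing here uses or asserts HC_CM).  Write `t(X) = dim MT(H¹X)`.  For a complex abelian variety
of positive dimension `t(X) = dim_ℚ Lie Hg(H¹X) + 1` (`mtRank_hodge_one_eq_finrank_hodgeLie_add_one`, Moonen–Zarhin §2:
`MT = 𝔾_m · Hg`), and `Hg(∏_j A_j) ⊆ ∏_j Hg(A_j)` (Moonen–Zarhin §3; Lie form with Künneth in degree one:
`AbelianVariety.finrank_hodgeLie_hodge_one_biproduct_le_sum`, gen 35).  Subtracting the common scalar factor `𝔾_m` once per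
factor gives the general a-priori bound of the ladder, stated here once and for all at the level of `t`:

* **`mtRank_hodge_one_add_card_le_sum_add_one_of_isIsogenous_biproduct`** — `t(X) + |J| ≤ (Σ_j t(A_j)) + 1` for
  `X ∼ ⨁_{j ∈ J} A_j` (all `dim A_j > 0`), i.e. `t(X) − 1 ≤ Σ_j (t(A_j) − 1)`;
* **`mtRank_hodge_one_add_one_le_add_of_isIsogenous_prod`** — `t(X) + 1 ≤ t(X₁) + t(X₂)` for `X ∼ X₁ × X₂`;
* **`mtRank_hodge_one_le_add_dim_of_isIsogenous_prod_of_isOfCMType`** — `t(X) ≤ t(X₁) + dim X₂` for `X ∼ X₁ × X₂` with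
  `X₂` of CM type (`t(X₂) ≤ dim X₂ + 1`, `mtRank_hodge_one_le_dim_add_one_of_isOfCMType`).

Equality in the second bullet holds when `Hg(X₁)` has no type-IV part and `X₂` is of CM type
(`CorCM/MumfordTateRankSemisimpleTimesCM`, Moonen–Zarhin Thm. (3.2)(2)); it fails in general (`X₁ = X₂ = E` a non-CM
curve: `t(E × E) = t(E) = 4 < 4 + 4 − 1`).  Earlier files contain the special shapes `X ∼ B^{a+1} × E^{b+1}`
(`MumfordTateRankFiveConverse`), `X ∼ B^{m+1} × Z` (`MumfordTateRankSixConverse` §1, Lie form) and CM families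
(`MumfordTateRankOfCMProducts`); this file is the general statement.

## References
* [MoonenZarhin1999LowDim] B. Moonen, Yu. Zarhin, *Hodge classes on abelian varieties of low dimension*, Math. Ann. 315
  (1999), §2 (`MT = 𝔾_m · Hg`) and §3 (`Hg(X₁ × X₂) ⊆ Hg(X₁) × Hg(X₂)`) [corpus: paper:arxiv-math_9901113 pp. 2, 6].
* [Deligne1982HodgeCycles] P. Deligne, *Hodge cycles on abelian varieties*, LNM 900 (1982), I §3.1, Prop. 3.4, Prop. 3.6.
* [MumfordAV1970] D. Mumford, *Abelian Varieties* (1970), §19 (products and isogenies).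
-/

noncomputable section

open CategoryTheory CategoryTheory.Limits Module

namespace Summit.HodgeConjecture.CorCM

open Literature.AlgebraicGeometry.Motives
open Literature.AlgebraicGeometry.Motives.AbelianVariety
open Literature.AlgebraicGeometry.Motives.HodgeStructure
open Literature.AlgebraicGeometry.HodgeTheory
open Literature.AlgebraicGeometry.Milne1999 (IsOfCMType)

variable [HodgeTensorFacts.{0, 0}] {X : AbelianVariety ℂ} {n : ℕ}

/-! ## §1 `X ∼ ⨁_j A_j` -/

/-- **`t(X) + |J| ≤ Σ_j t(A_j) + 1` for `X ∼ ⨁_{j ∈ J} A_j`** (`t = dim MT(H¹·)`, all `dim A_j > 0`, `dim X > 0`):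
isogeny invariance of `dim Lie Hg(H¹·)`, `dim Lie Hg(H¹(⨁_j A_j)) ≤ Σ_j dim Lie Hg(H¹A_j)` (`Hg(∏ A_j) ⊆ ∏ Hg(A_j)`) and
`t = dim Lie Hg + 1` on `X` and on every factor. [cite: MoonenZarhin1999LowDim, §2 and §3]
[cite: Deligne1982HodgeCycles, I §3.1 and Prop. 3.4] -/
theorem mtRank_hodge_one_add_card_le_sum_add_one_of_isIsogenous_biproduct {J : Type} [Fintype J] [DecidableEq J]
    {A : J → AbelianVariety ℂ} {d : J → ℕ} (hA : ∀ j, IsSmoothProjective (d j) (A j).X) (hA0 : ∀ j, 0 < (A j).dim)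
    (hX : IsSmoothProjective n X.X) (h0 : 0 < X.dim) (h : IsIsogenous X (⨁ A)) :
    haveI := BettiUniverse.finite hX 1
    haveI : ∀ j, Module.Finite ℚ (bettiCohomology (A j).X 1) := fun j => BettiUniverse.finite (hA j) 1
    (BettiUniverse.hodge exists_isReal_hodgeModel_holds hX 1).mtRank + Fintype.card J ≤
      (∑ j, (BettiUniverse.hodge exists_isReal_hodgeModel_holds (hA j) 1).mtRank) + 1 := by
  haveI := BettiUniverse.finite hX 1
  haveI : ∀ j, Module.Finite ℚ (bettiCohomology (A j).X 1) := fun j => BettiUniverse.finite (hA j) 1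
  have hP : IsSmoothProjective (⨁ A).dim (⨁ A).X := AbelianVariety.isSmoothProjective_holds
  haveI := BettiUniverse.finite hP 1
  have hsum : ∑ j, (BettiUniverse.hodge exists_isReal_hodgeModel_holds (hA j) 1).mtRank =
      ∑ j, (Module.finrank ℚ (BettiUniverse.hodge exists_isReal_hodgeModel_holds (hA j) 1).hodgeLie + 1) :=
    Finset.sum_congr rfl fun j _ => mtRank_hodge_one_eq_finrank_hodgeLie_add_one (hA j) (hA0 j)
  have h1 := finrank_hodgeLie_hodge_one_eq_of_isIsogenous hX hP h
  have h2 := finrank_hodgeLie_hodge_one_biproduct_le_sum hA hP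
  rw [mtRank_hodge_one_eq_finrank_hodgeLie_add_one hX h0, hsum, Finset.sum_add_distrib, Finset.sum_const, smul_eq_mul,
    mul_one, Finset.card_univ]
  omega

/-! ## §2 `X ∼ X₁ × X₂` -/

section Prod

variable {X₁ X₂ : AbelianVariety ℂ} {n₁ n₂ : ℕ} (hX₁ : IsSmoothProjective n₁ X₁.X) (hX₂ : IsSmoothProjective n₂ X₂.X)

omit [HodgeTensorFacts.{0, 0}] in
/-- `Y × Z ∼ ⨁ (Y, Z)`: the binary product is isomorphic to the biproduct of the pair family (both are bilimit bicones of the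
pair; private copy of the plumbing lemma of `MumfordTateRankSixConverse`). [cite: MumfordAV1970, §19] -/
private theorem isIsogenous_prod_biproduct_pairFunction' (Y Z : AbelianVariety ℂ) :
    IsIsogenous (Y.prod Z) (⨁ pairFunction Y Z) := by
  let e : (⨁ pairFunction Y Z) ≅ Y ⊞ Z :=
    biprod.uniqueUpToIso Y Z (b := (biproduct.bicone (pairFunction Y Z)).toBinaryBicone)
      ((Bicone.toBinaryBiconeIsBilimit _).symm (biproduct.isBilimit _))
  exact ⟨(biprodIsoProd Y Z).inv ≫ e.inv, isIsogeny_hom_of_iso ((biprodIsoProd Y Z).symm ≪≫ e.symm)⟩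

include hX₁ hX₂ in
/-- `dim Lie Hg(H¹X) ≤ dim Lie Hg(H¹X₁) + dim Lie Hg(H¹X₂)` for `X ∼ X₁ × X₂` (Künneth in degree one on `⨁ (X₁, X₂) ≅ X₁ × X₂`
and `Hg(X₁ × X₂) ⊆ Hg(X₁) × Hg(X₂)` in Lie form). [cite: MoonenZarhin1999LowDim, §3]
[cite: Deligne1982HodgeCycles, I §3.1 and Prop. 3.4] -/
theorem finrank_hodgeLie_hodge_one_le_add_of_isIsogenous_prod (hX : IsSmoothProjective n X.X)
    (h : IsIsogenous X (X₁.prod X₂)) :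
    haveI := BettiUniverse.finite hX 1
    haveI := BettiUniverse.finite hX₁ 1
    haveI := BettiUniverse.finite hX₂ 1
    Module.finrank ℚ (BettiUniverse.hodge exists_isReal_hodgeModel_holds hX 1).hodgeLie ≤
      Module.finrank ℚ (BettiUniverse.hodge exists_isReal_hodgeModel_holds hX₁ 1).hodgeLie +
        Module.finrank ℚ (BettiUniverse.hodge exists_isReal_hodgeModel_holds hX₂ 1).hodgeLie := by
  classical
  have hsp : ∀ A : AbelianVariety ℂ, IsSmoothProjective A.dim A.X := fun A => AbelianVariety.isSmoothProjective_holds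
  haveI := BettiUniverse.finite hX 1
  haveI := BettiUniverse.finite hX₁ 1
  haveI := BettiUniverse.finite hX₂ 1
  haveI : ∀ A : AbelianVariety ℂ, Module.Finite ℚ (bettiCohomology A.X 1) := fun A => BettiUniverse.finite (hsp A) 1
  -- `X ∼ X₁ × X₂ ∼ ⨁ (X₁, X₂)`
  have hXb : IsIsogenous X (⨁ pairFunction X₁ X₂) := h.trans (isIsogenous_prod_biproduct_pairFunction' X₁ X₂)
  have h1 := finrank_hodgeLie_hodge_one_eq_of_isIsogenous hX (hsp (⨁ pairFunction X₁ X₂)) hXb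
  have h2 := finrank_hodgeLie_hodge_one_biproduct_le_sum (A := pairFunction X₁ X₂)
    (d := fun j => (pairFunction X₁ X₂ j).dim) (fun j => hsp _) (hsp (⨁ pairFunction X₁ X₂))
  have hsum : ∑ j : WalkingPair, Module.finrank ℚ (BettiUniverse.hodge exists_isReal_hodgeModel_holds
      (hsp (pairFunction X₁ X₂ j)) 1).hodgeLie =
      Module.finrank ℚ (BettiUniverse.hodge exists_isReal_hodgeModel_holds (hsp X₁) 1).hodgeLie +
        Module.finrank ℚ (BettiUniverse.hodge exists_isReal_hodgeModel_holds (hsp X₂) 1).hodgeLie := by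
    rw [Fintype.sum_equiv WalkingPair.equivBool _
      (fun b => Module.finrank ℚ (BettiUniverse.hodge exists_isReal_hodgeModel_holds
        (hsp (pairFunction X₁ X₂ (WalkingPair.equivBool.symm b))) 1).hodgeLie)
      (fun j => by rw [Equiv.symm_apply_apply]), Fintype.sum_bool]
    rfl
  -- the Hodge structure `H¹(X_i)` does not depend on the smooth-projective witness: compare through the identity isogeny
  have h3 := finrank_hodgeLie_hodge_one_eq_of_isIsogenous (hsp X₁) hX₁ (IsIsogenous.refl X₁)
  have h4 := finrank_hodgeLie_hodge_one_eq_of_isIsogenous (hsp X₂) hX₂ (IsIsogenous.refl X₂)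
  rw [hsum] at h2
  omega

include hX₁ hX₂ in
/-- **`t(X) + 1 ≤ t(X₁) + t(X₂)` for `X ∼ X₁ × X₂`** (`t = dim MT(H¹·)`, `dim X₁, dim X₂ > 0`): `Hg(X₁ × X₂) ⊆ Hg(X₁) × Hg(X₂)`
and `MT = 𝔾_m · Hg` on the three varieties.  Equality holds when `Hg(X₁)` has trivial centre and `X₂` is of CM type
(Moonen–Zarhin Thm. (3.2)(2), `CorCM/MumfordTateRankSemisimpleTimesCM`), not in general. [cite: MoonenZarhin1999LowDim, §2 and §3]
[cite: Deligne1982HodgeCycles, I §3.1 and Prop. 3.4] -/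
theorem mtRank_hodge_one_add_one_le_add_of_isIsogenous_prod (h₁ : 0 < X₁.dim) (h₂ : 0 < X₂.dim)
    (hX : IsSmoothProjective n X.X) (h : IsIsogenous X (X₁.prod X₂)) :
    haveI := BettiUniverse.finite hX 1
    haveI := BettiUniverse.finite hX₁ 1
    haveI := BettiUniverse.finite hX₂ 1
    (BettiUniverse.hodge exists_isReal_hodgeModel_holds hX 1).mtRank + 1 ≤
      (BettiUniverse.hodge exists_isReal_hodgeModel_holds hX₁ 1).mtRank +
        (BettiUniverse.hodge exists_isReal_hodgeModel_holds hX₂ 1).mtRank := by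
  haveI := BettiUniverse.finite hX 1
  haveI := BettiUniverse.finite hX₁ 1
  haveI := BettiUniverse.finite hX₂ 1
  have h0 : 0 < X.dim := by
    obtain ⟨f, hf⟩ := h
    rw [dim_eq_of_isIsogeny hf, dim_prod]; omega
  have hle := finrank_hodgeLie_hodge_one_le_add_of_isIsogenous_prod hX₁ hX₂ hX h
  rw [mtRank_hodge_one_eq_finrank_hodgeLie_add_one hX h0, mtRank_hodge_one_eq_finrank_hodgeLie_add_one hX₁ h₁,
    mtRank_hodge_one_eq_finrank_hodgeLie_add_one hX₂ h₂]
  omega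

include hX₁ hX₂ in
/-- **`t(X) ≤ t(X₁) + dim X₂` for `X ∼ X₁ × X₂` with `X₂` of CM type** (`dim X₁, dim X₂ > 0`): `t(X) + 1 ≤ t(X₁) + t(X₂)` and
`t(X₂) ≤ dim X₂ + 1` for a CM abelian variety (`Hg(X₂)` is a torus of rank at most `dim X₂`).  Adding a CM factor raises the
Mumford–Tate rank by at most its dimension. [cite: MoonenZarhin1999LowDim, §2 and §3]
[cite: Gordon1999HodgeAVSurvey, 7.4 and 7.7] -/
theorem mtRank_hodge_one_le_add_dim_of_isIsogenous_prod_of_isOfCMType (h₁ : 0 < X₁.dim) (h₂ : 0 < X₂.dim)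
    (hcm : IsOfCMType X₂) (hX : IsSmoothProjective n X.X) (h : IsIsogenous X (X₁.prod X₂)) :
    haveI := BettiUniverse.finite hX 1
    haveI := BettiUniverse.finite hX₁ 1
    (BettiUniverse.hodge exists_isReal_hodgeModel_holds hX 1).mtRank ≤
      (BettiUniverse.hodge exists_isReal_hodgeModel_holds hX₁ 1).mtRank + X₂.dim := by
  haveI := BettiUniverse.finite hX 1
  haveI := BettiUniverse.finite hX₁ 1
  haveI := BettiUniverse.finite hX₂ 1
  have hle := mtRank_hodge_one_add_one_le_add_of_isIsogenous_prod hX₁ hX₂ h₁ h₂ hX h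
  have hcmle := mtRank_hodge_one_le_dim_add_one_of_isOfCMType hX₂ h₂ hcm
  omega

end Prod

end Summit.HodgeConjecture.CorCM

end
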